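import Summits.QuantumFields.QCD.Theses.SeaNonGibbs
import Literature.MathematicalPhysics.QuantumFieldTheory.QCDPhaseQuenchedPositivity
import Literature.MathematicalPhysics.QuantumFieldTheory.LatticeGaugeProofs
import HarnessLib

/-!
# Route `SeaNonGibbs` (QCD): the support item `SeaStatesExist` (stmt-QuantumFields-8859)

NON-VACUITY OF THE SEA STATES: for every number of flavours `N_f`, every inverse coupling `β` and
every real bare mass `m`, the unquenched (phase-quenched, `|det D_W|^{N_f}`) Wilson gauge marginals
on the four-tori `(ℤ/(n+1))⁴`, lifted periodically to `SU(3)^{edges(ℤ⁴)}`, have a subsequence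
converging on every bounded continuous cylinder observable to a probability measure `μ` on
`LGConfig 4 SU3`.

Proof. The item's inline weight `e^{-β S_W} |det D_W(U,m,1)|^{N_f} ∏ dU` is the tree's
`qcdLatticeWeight (n+1) β (m,…,m)` (`∏_f |det| = |det|^{N_f}`), so the normalised measure is
`qcdLatticeMeasure`, a probability measure at EVERY `(β, m)` by the tree's
`isProbabilityMeasure_qcdLatticeMeasure_all` (the weight is positive at the twisted free
configuration). The push-forwards along the periodic lifts are probability measures on the
compact metrizable space `SU(3)^{edges(ℤ⁴)}`, on which Mathlib's `ProbabilityMeasure` is compact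
and (Lévy–Prokhorov) metrizable, so a convergent subsequence exists
(`IsCompact.tendsto_subseq`), and weak convergence is convergence of the integrals of bounded
continuous functions (`ProbabilityMeasure.tendsto_iff_forall_integral_tendsto`) — exactly as for
the pure-gauge torus states (`infiniteVolumeLimitPoints_nonempty_holds`). Nothing here bears on
confinement or the mass gap; no summit, leg or crux statement is proved (seat ym-line-fcl-p3 g19,
free hands).
-/

noncomputable section

open MeasureTheory Filter Topology
open Literature.MathematicalPhysics.QuantumFieldTheory Literature.MathematicalPhysics.QuantumLattice

namespace Summit.QuantumFields.QCD.Theorems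

/-- **Item stmt-QuantumFields-8859 `SeaNonGibbs.SeaStatesExist` holds**: subsequential
infinite-volume limits of the lattice-QCD sea measures exist for every `N_f`, `β`, `m`
(compactness of `SU(3)^{edges}`; Seiler LNP 159 Ch. 2, Georgii 2011 §4.3). -/
theorem seaNonGibbs_seaStatesExist_proof : Theses.SeaNonGibbs.SeaStatesExist := by
  intro Nf β m w sea
  have hsea : ∀ n : ℕ, sea n = qcdLatticeMeasure (n + 1) β (fun _ : Fin Nf => m) := fun n => by
    simp only [sea, w, qcdLatticeMeasure, qcdLatticeWeight, Finset.prod_const, Finset.card_univ,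
      Fintype.card_fin]
  haveI hprob : ∀ n : ℕ, IsProbabilityMeasure (sea n) := fun n => by
    rw [hsea]
    exact isProbabilityMeasure_qcdLatticeMeasure_all β _
  haveI : ∀ n : ℕ, IsProbabilityMeasure ((sea n).map (torusLift (d := 4) (n + 1))) := fun n =>
    Measure.isProbabilityMeasure_map (measurable_torusLift (n + 1)).aemeasurable
  let P : ℕ → ProbabilityMeasure (LGConfig 4 SU3) := fun n =>
    ⟨(sea n).map (torusLift (d := 4) (n + 1)), inferInstance⟩
  obtain ⟨μ, -, φ, hφ, hlim⟩ :=
    (isCompact_univ (X := ProbabilityMeasure (LGConfig 4 SU3))).tendsto_subseq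
      fun n => Set.mem_univ (P n)
  refine ⟨(μ : Measure (LGConfig 4 SU3)), φ, hφ, inferInstance, fun F S _ hFc hFb => ?_⟩
  obtain ⟨C, hC⟩ := hFb
  let Fb : BoundedContinuousFunction (LGConfig 4 SU3) ℝ :=
    BoundedContinuousFunction.ofNormedAddCommGroup F hFc C
      (fun U => by simpa [Real.norm_eq_abs] using hC U)
  have hE : (fun k : ℕ => ∫ U, F (torusLift (φ k + 1) U) ∂(sea (φ k))) =
      fun k => ∫ U, Fb U ∂(P (φ k) : Measure (LGConfig 4 SU3)) := by
    funext k
    change _ = ∫ U, F U ∂((sea (φ k)).map (torusLift (d := 4) (φ k + 1)))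
    rw [integral_map (measurable_torusLift _).aemeasurable hFc.measurable.aestronglyMeasurable]
  have key : Tendsto (fun k : ℕ => ∫ U, Fb U ∂(P (φ k) : Measure (LGConfig 4 SU3))) atTop
      (𝓝 (∫ U, Fb U ∂(μ : Measure (LGConfig 4 SU3)))) :=
    (ProbabilityMeasure.tendsto_iff_forall_integral_tendsto.1 hlim) Fb
  rw [hE]
  exact key

end Summit.QuantumFields.QCD.Theorems

end
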